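import Summits.Parity.BatemanHorn.Theorems.RoughValueTransportBalancedSemiprimeLayerRoughWindowTypeIDegOne
import HarnessLib

/-!
# Route `RoughValueTransport`, crux `BalancedSemiprimeLayer` (stmt-Parity-9469), line
# `rough-relaxed-divisor-sieve` (seat c2): the residual is a statement about ONE polynomial

The registered skeleton `Cruxes/BalancedSemiprimeLayer/Lines/rough_relaxed_divisor_sieve_c1.lean`
(r3, companion seat c1) closes the crux BY NAME modulo the single Type-I stub
`stub_roughWindowTypeI_highDegree : IsBatemanHornSystem f → 3 ≤ deg fᵢ → RoughWindowTypeI f i`.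
`RoughWindowTypeI f i` still speaks about the whole SYSTEM `f`: its counts run over
`posRange f x = {1 ≤ n ≤ x : every fⱼ(n) > 0}` and are twisted by `e ∣ F(n)`, `F = ∏ⱼ fⱼ`, with the
main term `x·(ρᵢ(m)/m)·(ρ_F(e)/e)`.

This file (stub S9 `stub_rootLevelTransfer` of skeleton r4, seat c2) removes the system: for every
coordinate `g = fᵢ` of degree `≥ 2` of a Bateman–Horn system, `RoughWindowTypeI f i` follows from
the SINGLE-POLYNOMIAL root-level statement

  `∃ c₀ > 0, ∀ 0 < c ≤ c₀, ∀ 0 < δ ≤ c, ∃ η > 0, ∀ᶠ x,`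
  `∑_{e ≤ x^c, e squarefree} ∑_{s mod e} |∑_{m ∈ roughDivWindow (deg g) δ c x}`
  `( #{1 ≤ n ≤ x : n ≡ s (mod e), m ∣ g(n)} − (x/e)·(ρ_g(m)/m) )| ≤ x^{1−η}`

(roots of `g` modulo the rough squarefree moduli of the balanced window, counted in the initial
segment `[1, x]` of one period inside every progression `s mod e`, power saving; no system, no
`posRange`, no product `F`, no sieve, no primes).  With it the residual registered for the planner is
`stub_roughWindowRootLevel_highDegree : ∀ g, Irreducible g → 0 < lc g → 3 ≤ deg g → (the display)`.

Proof.  Fix `e ≥ 1` and any finset `T` of moduli.  (i) Fibre the count over `(0, x]` by the residue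
of `n` mod `e`: `#{n ≤ x : m ∣ g(n), e ∣ F(n)} = ∑_{s mod e, e ∣ F(s)} #{n ≤ x : n ≡ s (e), m ∣ g(n)}`
(`card_filter_dvd_eval_eq_sum`), and the main term splits the same way because
`ρ_F(e) = #{s mod e : e ∣ F(s)}` (`polyRootCountMod_eq_single_prod`,
`card_filter_dvd_eval_eq_polyRootCountMod`).  (ii) The count over `posRange f x` differs from the
count over `(0, x]` by at most `#{n < n₀ : m ∣ g(n)}` (`n₀` = onset of positivity of the system), and
`∑_{m ∈ T} #{n < n₀ : m ∣ g(n)} = ∑_{n < n₀} #{m ∈ T : m ∣ g(n)} ≤ ∑_{n < n₀} |g(n)| =: K_f`, a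
constant, because `g(n) ≠ 0` (an irreducible polynomial of degree `≥ 2` has no integer root) and a
nonzero integer has at most `|N|` divisors.  (iii) Hence
`|∑_{m ∈ T} r(x; m, e)| ≤ ∑_{s mod e} |∑_{m ∈ T} (count − main)| + K_f` (the root classes are a
subset of all classes), and summing over the `≤ x^c` squarefree `e`:
`∑_e |∑_m r| ≤ x^{1−η} + K_f·x^c ≤ x^{1−η'}` eventually, `η' = min(η, 1/2)/2`, once `c ≤ 1/4`
(`c₀' = min(c₀, 1/4)`).

References: bookkeeping only (Halberstam–Richert, *Sieve Methods*, §1.4 conventions); everything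
used is PROVED in the tree (`card_filter_dvd_eval_eq_sum`, `card_filter_dvd_eval_eq_polyRootCountMod`,
`PolyPrimeCountBrun.polyRootCountMod_eq_single_prod`, `windowPairCount_le_and_le`,
`exists_forall_eval_pos`, `Polynomial.degree_eq_one_of_irreducible_of_root`).
-/

noncomputable section

open Polynomial Filter Finset
open Literature.NumberTheory.Sieve

namespace Summit.Parity.BatemanHorn.Cruxes.BalancedSemiprimeLayer.RoughRelaxedDivisorSieve

/-! ### No integer roots in degree `≥ 2`; divisors of a fixed nonzero integer -/

/-- An irreducible integer polynomial of degree `≥ 2` has no integer root (a root `n` would make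
`X − n` a proper factor: `degree_eq_one_of_irreducible_of_root`). [folklore] -/
theorem eval_ne_zero_of_irreducible_of_two_le {g : ℤ[X]} (hg : Irreducible g)
    (hd : 2 ≤ g.natDegree) (n : ℤ) : g.eval n ≠ 0 := by
  intro h
  have h1 : g.degree = 1 := degree_eq_one_of_irreducible_of_root hg h
  have h2 : g.natDegree = 1 := natDegree_eq_of_degree_eq_some h1
  omega

/-- A nonzero integer `N` has at most `|N|` divisors inside any finset of natural moduli. [folklore] -/
theorem card_filter_natCast_dvd_le_natAbs (T : Finset ℕ) {N : ℤ} (hN : N ≠ 0) :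
    #(T.filter fun m : ℕ => (m : ℤ) ∣ N) ≤ N.natAbs := by
  calc #(T.filter fun m : ℕ => (m : ℤ) ∣ N) ≤ #(Icc 1 N.natAbs) := by
        refine card_le_card fun m hm => ?_
        rw [mem_filter] at hm
        have hdvd : m ∣ N.natAbs := Int.natCast_dvd.mp hm.2
        rw [mem_Icc]
        refine ⟨Nat.pos_of_ne_zero ?_, Nat.le_of_dvd (Int.natAbs_pos.mpr hN) hdvd⟩
        rintro rfl
        rw [zero_dvd_iff] at hdvd
        exact hN (Int.natAbs_eq_zero.mp hdvd)
    _ = N.natAbs := by simp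

/-- Double counting: over ANY finset `T` of moduli,
`∑_{m ∈ T} #{n < n₀ : m ∣ g(n)} ≤ ∑_{n < n₀} |g(n)|` when `g` has no root in `ℕ`. [folklore] -/
theorem sum_card_filter_dvd_eval_le (g : ℤ[X]) (T : Finset ℕ) (n₀ : ℕ)
    (hg : ∀ n : ℕ, g.eval (n : ℤ) ≠ 0) :
    ∑ m ∈ T, #((range n₀).filter fun n : ℕ => (m : ℤ) ∣ g.eval (n : ℤ)) ≤
      ∑ n ∈ range n₀, (g.eval (n : ℤ)).natAbs := by
  calc ∑ m ∈ T, #((range n₀).filter fun n : ℕ => (m : ℤ) ∣ g.eval (n : ℤ))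
      = ∑ m ∈ T, ∑ n ∈ range n₀, (if (m : ℤ) ∣ g.eval (n : ℤ) then 1 else 0) :=
        Finset.sum_congr rfl fun m _ => Finset.card_filter _ _
    _ = ∑ n ∈ range n₀, ∑ m ∈ T, (if (m : ℤ) ∣ g.eval (n : ℤ) then 1 else 0) := Finset.sum_comm
    _ = ∑ n ∈ range n₀, #(T.filter fun m : ℕ => (m : ℤ) ∣ g.eval (n : ℤ)) :=
        Finset.sum_congr rfl fun n _ => (Finset.card_filter _ _).symm
    _ ≤ ∑ n ∈ range n₀, (g.eval (n : ℤ)).natAbs :=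
        Finset.sum_le_sum fun n _ => card_filter_natCast_dvd_le_natAbs T (hg n)

/-! ### Fibration of the pair count and of its main term over the classes of the sieve modulus -/

/-- `#{1 ≤ n ≤ x : m ∣ g(n), e ∣ F(n)} = ∑_{s mod e, e ∣ F(s)} #{1 ≤ n ≤ x : n ≡ s (mod e), m ∣ g(n)}`
for `e ≥ 1` (`card_filter_dvd_eval_eq_sum` in the variable `e`). [folklore] -/
theorem card_filter_dvd_pair_eq_sum_classes (g F : ℤ[X]) (m : ℕ) {e : ℕ} (he : 0 < e) (x : ℕ) :
    #((Ioc 0 x).filter fun n : ℕ => (m : ℤ) ∣ g.eval (n : ℤ) ∧ (e : ℤ) ∣ F.eval (n : ℤ)) =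
      ∑ s ∈ (range e).filter (fun s : ℕ => (e : ℤ) ∣ F.eval (s : ℤ)),
        #((Ioc 0 x).filter fun n : ℕ => n ≡ s [MOD e] ∧ (m : ℤ) ∣ g.eval (n : ℤ)) := by
  rw [show ((Ioc 0 x).filter fun n : ℕ => (m : ℤ) ∣ g.eval (n : ℤ) ∧ (e : ℤ) ∣ F.eval (n : ℤ)) =
      ((Ioc 0 x).filter fun n : ℕ => (m : ℤ) ∣ g.eval (n : ℤ)).filter
        (fun n : ℕ => (e : ℤ) ∣ F.eval (n : ℤ)) from (Finset.filter_filter _ _ _).symm,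
    card_filter_dvd_eval_eq_sum F _ he]
  refine Finset.sum_congr rfl fun s _ => ?_
  rw [Finset.filter_filter]
  congr 1
  exact Finset.filter_congr fun n _ => and_comm

/-- The CRT main term splits over the root classes of `F = ∏ⱼ fⱼ` modulo `e ≥ 1`:
`x·(ρ_g(m)/m)·(ρ_F(e)/e) = ∑_{s mod e, e ∣ F(s)} (x/e)·(ρ_g(m)/m)` (`ρ_F(e) = #{s mod e : e ∣ F(s)}`). [folklore] -/
theorem mainTerm_eq_sum_classes {k : ℕ} (f : Fin k → ℤ[X]) (g : ℤ[X]) (m : ℕ) {e : ℕ}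
    (he : 0 < e) (x : ℕ) :
    (x : ℝ) * ((polyRootCountMod ![g] m : ℝ) / m) * ((polyRootCountMod f e : ℝ) / e) =
      ∑ _s ∈ (range e).filter (fun s : ℕ => (e : ℤ) ∣ (∏ j, f j).eval (s : ℤ)),
        (x : ℝ) / e * ((polyRootCountMod ![g] m : ℝ) / m) := by
  rw [Finset.sum_const, nsmul_eq_mul, card_filter_dvd_eval_eq_polyRootCountMod,
    ← PolyPrimeCountBrun.polyRootCountMod_eq_single_prod f e]
  have he' : (e : ℝ) ≠ 0 := by exact_mod_cast he.ne'
  field_simp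

/-! ### The pair count over `posRange f x` against the count over all of `(0, x]` -/

/-- If every `fⱼ(n) > 0` for `n ≥ n₀`, the count over `(0, x]` exceeds `windowPairCount` by at most
`#{n < n₀ : m ∣ fᵢ(n)}` (the missing `n` are `< n₀` and keep `m ∣ fᵢ(n)`). [folklore] -/
theorem card_filter_pair_le_windowPairCount_add {k : ℕ} (f : Fin k → ℤ[X]) (i : Fin k) {n₀ : ℕ}
    (hn₀ : ∀ n : ℕ, n₀ ≤ n → ∀ j, 0 < (f j).eval (n : ℤ)) (x m e : ℕ) :
    #((Ioc 0 x).filter fun n : ℕ =>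
        (m : ℤ) ∣ (f i).eval (n : ℤ) ∧ (e : ℤ) ∣ (∏ j, f j).eval (n : ℤ)) ≤
      windowPairCount f i x m e +
        #((range n₀).filter fun n : ℕ => (m : ℤ) ∣ (f i).eval (n : ℤ)) := by
  unfold windowPairCount
  have hdiff : ((Ioc 0 x).filter fun n : ℕ =>
        (m : ℤ) ∣ (f i).eval (n : ℤ) ∧ (e : ℤ) ∣ (∏ j, f j).eval (n : ℤ)) \
      (posRange f x).filter (fun n : ℕ =>
        ((m : ℤ) ∣ (f i).eval (n : ℤ)) ∧ ((e : ℤ) ∣ ∏ j, (f j).eval (n : ℤ))) ⊆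
      (range n₀).filter fun n : ℕ => (m : ℤ) ∣ (f i).eval (n : ℤ) := by
    intro n hn
    rw [Finset.mem_sdiff] at hn
    obtain ⟨hn1, hn2⟩ := hn
    rw [mem_filter, mem_Ioc, eval_prod] at hn1
    rw [mem_filter, mem_range]
    refine ⟨?_, hn1.2.1⟩
    by_contra hlt
    apply hn2
    rw [mem_filter, mem_posRange, mem_Icc]
    exact ⟨⟨⟨hn1.1.1, hn1.1.2⟩, hn₀ n (not_lt.mp hlt)⟩, hn1.2⟩
  calc _ ≤ _ := card_le_card_sdiff_add_card
    _ ≤ _ := Nat.add_le_add_right (card_le_card hdiff) _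
    _ = _ := add_comm _ _

/-- **Per-modulus decomposition of the remainder.**  For `e ≥ 1` and every `m`, with `n₀` the onset
of positivity: `r(x; m, e) = ∑_{s mod e, e ∣ F(s)} D(m, s) − θ` with
`D(m, s) = #{1 ≤ n ≤ x : n ≡ s (e), m ∣ fᵢ(n)} − (x/e)·(ρᵢ(m)/m)` and
`0 ≤ θ ≤ #{n < n₀ : m ∣ fᵢ(n)}`. [folklore] -/
theorem windowPairRem_eq_sum_classes_sub {k : ℕ} (f : Fin k → ℤ[X]) (i : Fin k) {n₀ : ℕ}
    (hn₀ : ∀ n : ℕ, n₀ ≤ n → ∀ j, 0 < (f j).eval (n : ℤ)) (x m : ℕ) {e : ℕ} (he : 0 < e) :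
    ∃ θ : ℝ, 0 ≤ θ ∧ θ ≤ #((range n₀).filter fun n : ℕ => (m : ℤ) ∣ (f i).eval (n : ℤ)) ∧
      windowPairRem f i x m e =
        (∑ s ∈ (range e).filter (fun s : ℕ => (e : ℤ) ∣ (∏ j, f j).eval (s : ℤ)),
          (((#((Ioc 0 x).filter fun n : ℕ => n ≡ s [MOD e] ∧ (m : ℤ) ∣ (f i).eval (n : ℤ))) : ℝ) -
            (x : ℝ) / e * ((polyRootCountMod ![f i] m : ℝ) / m))) - θ := by
  have hlo := (windowPairCount_le_and_le f i hn₀ x m e).1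
  have hhi := card_filter_pair_le_windowPairCount_add f i hn₀ x m e
  refine ⟨(#((Ioc 0 x).filter fun n : ℕ =>
        (m : ℤ) ∣ (f i).eval (n : ℤ) ∧ (e : ℤ) ∣ (∏ j, f j).eval (n : ℤ)) : ℝ) -
      windowPairCount f i x m e, ?_, ?_, ?_⟩
  · rw [sub_nonneg]
    exact_mod_cast hlo
  · have h' : ((#((Ioc 0 x).filter fun n : ℕ =>
        (m : ℤ) ∣ (f i).eval (n : ℤ) ∧ (e : ℤ) ∣ (∏ j, f j).eval (n : ℤ)) : ℕ) : ℝ) ≤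
        (windowPairCount f i x m e : ℝ) +
          #((range n₀).filter fun n : ℕ => (m : ℤ) ∣ (f i).eval (n : ℤ)) := by
      exact_mod_cast hhi
    linarith
  · unfold windowPairRem
    rw [Finset.sum_sub_distrib, ← mainTerm_eq_sum_classes f (f i) m he x]
    have hA : ((#((Ioc 0 x).filter fun n : ℕ =>
        (m : ℤ) ∣ (f i).eval (n : ℤ) ∧ (e : ℤ) ∣ (∏ j, f j).eval (n : ℤ)) : ℕ) : ℝ) =
        ∑ s ∈ (range e).filter (fun s : ℕ => (e : ℤ) ∣ (∏ j, f j).eval (s : ℤ)),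
          ((#((Ioc 0 x).filter fun n : ℕ => n ≡ s [MOD e] ∧ (m : ℤ) ∣ (f i).eval (n : ℤ))) : ℝ) := by
      rw [card_filter_dvd_pair_eq_sum_classes (f i) (∏ j, f j) m he x]
      push_cast
      rfl
    rw [← hA]
    ring

/-! ### One sieve modulus: the remainder sum against the per-class remainder sums -/

/-- **Per-`e` transfer.**  For `e ≥ 1`, ANY finset `T` of moduli, `n₀` the onset of positivity and
`fᵢ` without roots in `ℕ`:
`|∑_{m ∈ T} r(x; m, e)| ≤ ∑_{s mod e} |∑_{m ∈ T} D(m, s)| + ∑_{n < n₀} |fᵢ(n)|`. [folklore] -/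
theorem abs_sum_windowPairRem_le_sum_classes {k : ℕ} {f : Fin k → ℤ[X]} (i : Fin k) {n₀ : ℕ}
    (hn₀ : ∀ n : ℕ, n₀ ≤ n → ∀ j, 0 < (f j).eval (n : ℤ))
    (hg : ∀ n : ℕ, (f i).eval (n : ℤ) ≠ 0) (T : Finset ℕ) (x : ℕ) {e : ℕ} (he : 0 < e) :
    |∑ m ∈ T, windowPairRem f i x m e| ≤
      (∑ s ∈ range e, |∑ m ∈ T,
          (((#((Ioc 0 x).filter fun n : ℕ => n ≡ s [MOD e] ∧ (m : ℤ) ∣ (f i).eval (n : ℤ))) : ℝ) -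
            (x : ℝ) / e * ((polyRootCountMod ![f i] m : ℝ) / m))|) +
        ∑ n ∈ range n₀, (((f i).eval (n : ℤ)).natAbs : ℝ) := by
  have h := fun m => windowPairRem_eq_sum_classes_sub f i hn₀ x m he
  choose θ hθ0 hθB hθr using h
  have hsum : ∑ m ∈ T, windowPairRem f i x m e =
      (∑ s ∈ (range e).filter (fun s : ℕ => (e : ℤ) ∣ (∏ j, f j).eval (s : ℤ)), ∑ m ∈ T,
          ((((#((Ioc 0 x).filter fun n : ℕ => n ≡ s [MOD e] ∧ (m : ℤ) ∣ (f i).eval (n : ℤ))) : ℝ) -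
            (x : ℝ) / e * ((polyRootCountMod ![f i] m : ℝ) / m)))) - ∑ m ∈ T, θ m := by
    rw [Finset.sum_comm, ← Finset.sum_sub_distrib]
    exact Finset.sum_congr rfl fun m _ => hθr m
  have hθsum : ∑ m ∈ T, θ m ≤ ∑ n ∈ range n₀, (((f i).eval (n : ℤ)).natAbs : ℝ) := by
    calc ∑ m ∈ T, θ m
        ≤ ∑ m ∈ T, ((#((range n₀).filter fun n : ℕ => (m : ℤ) ∣ (f i).eval (n : ℤ)) : ℕ) : ℝ) :=
          Finset.sum_le_sum fun m _ => hθB m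
      _ ≤ ∑ n ∈ range n₀, (((f i).eval (n : ℤ)).natAbs : ℝ) := by
          exact_mod_cast sum_card_filter_dvd_eval_le (f i) T n₀ hg
  have hθnn : 0 ≤ ∑ m ∈ T, θ m := Finset.sum_nonneg fun m _ => hθ0 m
  rw [hsum]
  refine (abs_sub _ _).trans ?_
  rw [abs_of_nonneg hθnn]
  refine add_le_add ((Finset.abs_sum_le_sum_abs _ _).trans ?_) hθsum
  exact Finset.sum_le_sum_of_subset_of_nonneg (Finset.filter_subset _ _)
    fun s _ _ => abs_nonneg _

/-! ### The stub -/

/-- **S9 `stub_rootLevelTransfer`** (registered stub of skeleton r4, seat c2).  For every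
Bateman–Horn system `f` and every coordinate `i` of degree `≥ 2`, the SINGLE-POLYNOMIAL root-level
statement for `g = fᵢ` (roots of `g` modulo the rough squarefree moduli of the balanced window,
counted in `[1, x]` inside every progression `s mod e`, `e ≤ x^c` squarefree, power saving) implies
`RoughWindowTypeI f i` (with `c₀' = min(c₀, 1/4)` and saving `min(η, 1/2)/2`): the system enters
`RoughWindowTypeI` only through the onset of positivity `n₀(f)` and the root classes of `∏ⱼ fⱼ`
mod `e`, both absorbed here. [folklore] -/
theorem stub_rootLevelTransfer :
    ∀ (k : ℕ) (f : Fin k → ℤ[X]), IsBatemanHornSystem f → ∀ i : Fin k, 2 ≤ (f i).natDegree →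
      (∃ c₀ : ℝ, 0 < c₀ ∧ ∀ c : ℝ, 0 < c → c ≤ c₀ → ∀ δ : ℝ, 0 < δ → δ ≤ c →
        ∃ η : ℝ, 0 < η ∧ ∀ᶠ x : ℕ in Filter.atTop,
          (∑ e ∈ (Finset.Icc 1 ⌊(x : ℝ) ^ c⌋₊).filter Squarefree, ∑ s ∈ Finset.range e,
            |∑ m ∈ roughDivWindow (f i).natDegree δ c x,
              ((#((Finset.Ioc 0 x).filter fun n : ℕ =>
                  n ≡ s [MOD e] ∧ (m : ℤ) ∣ (f i).eval (n : ℤ)) : ℝ) -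
                (x : ℝ) / e * ((polyRootCountMod ![f i] m : ℝ) / m))|) ≤ (x : ℝ) ^ (1 - η)) →
      RoughWindowTypeI f i := by
  intro k f hf i hdeg hH
  obtain ⟨c₀, hc₀, H⟩ := hH
  obtain ⟨n₀, hn₀⟩ := exists_forall_eval_pos hf
  have hg : ∀ n : ℕ, (f i).eval (n : ℤ) ≠ 0 :=
    fun n => eval_ne_zero_of_irreducible_of_two_le (hf.irreducible i) hdeg n
  set K : ℝ := ∑ n ∈ range n₀, (((f i).eval (n : ℤ)).natAbs : ℝ) with hK
  have hK0 : 0 ≤ K := Finset.sum_nonneg fun n _ => Nat.cast_nonneg _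
  refine ⟨min c₀ (1 / 4), lt_min hc₀ (by norm_num), fun c hc hcc δ hδ hδc => ?_⟩
  obtain ⟨η, hη, hev⟩ := H c hc (hcc.trans (min_le_left _ _)) δ hδ hδc
  have hc4 : c ≤ 1 / 4 := hcc.trans (min_le_right _ _)
  -- the new saving `η' = min(η, 1/2)/2`
  have hm0 : 0 < min η (1 / 2) := lt_min hη (by norm_num)
  have hm1 : min η (1 / 2) ≤ η := min_le_left _ _
  have hm2 : min η (1 / 2) ≤ 1 / 2 := min_le_right _ _
  refine ⟨min η (1 / 2) / 2, by positivity, ?_⟩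
  have hT1 : Tendsto (fun x : ℕ => (x : ℝ) ^ (η - min η (1 / 2) / 2)) atTop atTop :=
    (tendsto_rpow_atTop (by linarith)).comp tendsto_natCast_atTop_atTop
  have hT2 : Tendsto (fun x : ℕ => (x : ℝ) ^ (1 - min η (1 / 2) / 2 - c)) atTop atTop :=
    (tendsto_rpow_atTop (by linarith)).comp tendsto_natCast_atTop_atTop
  filter_upwards [hev, hT1.eventually_ge_atTop 2, hT2.eventually_ge_atTop (2 * K),
    eventually_ge_atTop 1] with x hx h1 h2 hx1
  have hX : (1 : ℝ) ≤ x := by exact_mod_cast hx1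
  have hXpos : (0 : ℝ) < x := by linarith
  -- per-`e` transfer
  have hpt : ∀ e ∈ (Icc 1 ⌊(x : ℝ) ^ c⌋₊).filter Squarefree,
      |∑ m ∈ roughDivWindow (f i).natDegree δ c x, windowPairRem f i x m e| ≤
        (∑ s ∈ range e, |∑ m ∈ roughDivWindow (f i).natDegree δ c x,
          (((#((Ioc 0 x).filter fun n : ℕ => n ≡ s [MOD e] ∧ (m : ℤ) ∣ (f i).eval (n : ℤ))) : ℝ) -
            (x : ℝ) / e * ((polyRootCountMod ![f i] m : ℝ) / m))|) + K := by
    intro e he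
    rw [mem_filter, mem_Icc] at he
    exact abs_sum_windowPairRem_le_sum_classes i hn₀ hg _ x he.1.1
  -- the number of sieve moduli
  have hE : (#((Icc 1 ⌊(x : ℝ) ^ c⌋₊).filter Squarefree) : ℝ) ≤ (x : ℝ) ^ c := by
    have hxc0 : (0 : ℝ) ≤ (x : ℝ) ^ c := Real.rpow_nonneg (Nat.cast_nonneg _) _
    calc (#((Icc 1 ⌊(x : ℝ) ^ c⌋₊).filter Squarefree) : ℝ) ≤ #(Icc 1 ⌊(x : ℝ) ^ c⌋₊) := by
          exact_mod_cast card_filter_le _ _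
      _ = ⌊(x : ℝ) ^ c⌋₊ := by rw [Nat.card_Icc, Nat.add_sub_cancel]
      _ ≤ (x : ℝ) ^ c := Nat.floor_le hxc0
  -- exponent budget
  have e1 : (x : ℝ) ^ (1 - η) * (x : ℝ) ^ (η - min η (1 / 2) / 2) =
      (x : ℝ) ^ (1 - min η (1 / 2) / 2) := by
    rw [← Real.rpow_add hXpos]
    congr 1
    ring
  have e2 : (x : ℝ) ^ c * (x : ℝ) ^ (1 - min η (1 / 2) / 2 - c) =
      (x : ℝ) ^ (1 - min η (1 / 2) / 2) := by
    rw [← Real.rpow_add hXpos]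
    congr 1
    ring
  have hA : (x : ℝ) ^ (1 - η) * 2 ≤ (x : ℝ) ^ (1 - min η (1 / 2) / 2) := by
    rw [← e1]
    exact mul_le_mul_of_nonneg_left h1 (Real.rpow_nonneg hXpos.le _)
  have hB : (x : ℝ) ^ c * (2 * K) ≤ (x : ℝ) ^ (1 - min η (1 / 2) / 2) := by
    rw [← e2]
    exact mul_le_mul_of_nonneg_left h2 (Real.rpow_nonneg hXpos.le _)
  calc ∑ e ∈ (Icc 1 ⌊(x : ℝ) ^ c⌋₊).filter Squarefree,
        |∑ m ∈ roughDivWindow (f i).natDegree δ c x, windowPairRem f i x m e|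
      ≤ ∑ e ∈ (Icc 1 ⌊(x : ℝ) ^ c⌋₊).filter Squarefree,
          ((∑ s ∈ range e, |∑ m ∈ roughDivWindow (f i).natDegree δ c x,
            (((#((Ioc 0 x).filter fun n : ℕ => n ≡ s [MOD e] ∧ (m : ℤ) ∣ (f i).eval (n : ℤ))) : ℝ) -
              (x : ℝ) / e * ((polyRootCountMod ![f i] m : ℝ) / m))|) + K) :=
        Finset.sum_le_sum hpt
    _ = (∑ e ∈ (Icc 1 ⌊(x : ℝ) ^ c⌋₊).filter Squarefree,
          ∑ s ∈ range e, |∑ m ∈ roughDivWindow (f i).natDegree δ c x,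
            (((#((Ioc 0 x).filter fun n : ℕ => n ≡ s [MOD e] ∧ (m : ℤ) ∣ (f i).eval (n : ℤ))) : ℝ) -
              (x : ℝ) / e * ((polyRootCountMod ![f i] m : ℝ) / m))|) +
          (#((Icc 1 ⌊(x : ℝ) ^ c⌋₊).filter Squarefree) : ℝ) * K := by
        rw [Finset.sum_add_distrib, Finset.sum_const, nsmul_eq_mul]
    _ ≤ (x : ℝ) ^ (1 - η) + (x : ℝ) ^ c * K :=
        add_le_add hx (mul_le_mul_of_nonneg_right hE hK0)
    _ ≤ (x : ℝ) ^ (1 - min η (1 / 2) / 2) := by nlinarith [hA, hB, hK0]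

end Summit.Parity.BatemanHorn.Cruxes.BalancedSemiprimeLayer.RoughRelaxedDivisorSieve
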